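import Summits.BirchSwinnertonDyer.BirchSwinnertonDyer.Theses.RamifiedSevenEllipticUnits
import Literature.NumberTheory.EllipticCurves.LocalRestrictionDegree
import Literature.NumberTheory.EllipticCurves.SelmerPInftyRestriction
import Literature.NumberTheory.EllipticCurves.QuadraticTwistSelmerPInfty
import Literature.NumberTheory.EllipticCurves.BSDSelmer
import HarnessLib

set_option linter.dupNamespace false
set_option autoImplicit false

/-!
# Route `RamifiedSevenEllipticUnits` (rung K7r), crux `StrictControlSeven` (stmt-BirchSwinnertonDyer-19145):
# the STRICT local condition along a TOWER of local fields (bricks (s2)/(s4) of the twist-descent step)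

Cell `bsd-cm`, seat `bsd-cm-k7r-c4` (g0). HONEST FRAMING: nothing here closes the crux; BSD is not
proved by any of this. These are the `p^∞`-torsion-coefficient companions of the tree's tower
lemmas for the local kernels of `H¹(K, E)` (`ShaRestriction.localRestrictionKer_le_of_tower`,
`LocalRestrictionDegree.index_nsmul_mem_localRestrictionKer_of_tower`), needed to compare the strict
condition of `Sel_str(E/ℚ)[p^∞]` at `ℚ_p` with the strict conditions of its restriction over the
quadratic field `K` at the primes `𝔮 ∣ p` (Dokchitser–Dokchitser 2010, Lemma 4.14, strict variant).

## What is proved (any field `K`, Weierstrass curve `W/K`, prime `p`, `K`-fields `E → E'`)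

* `selmerLocalKerPrimaryTorsion_eq_resKer_ofEmb` — the strict local kernel
  `ker (H¹(K, E[p^∞]) → H¹(E, E(K̄_E)[p^∞]))` does not depend on the `K`-embedding `K̄ → K̄_E`
  (inner automorphisms act trivially on `H¹`; `resKer_conj_comp`).
* `selmerLocalKerPrimaryTorsion_le_of_tower` — **strict local kernels grow along a tower**
  `K → E → E'`: a class dying in `H¹(E, E(K̄_E)[p^∞])` dies in `H¹(E', E(K̄_{E'})[p^∞])`.
* `index_nsmul_mem_selmerLocalKerPrimaryTorsion_of_tower`,
  `two_nsmul_mem_selmerLocalKerPrimaryTorsion_of_tower` — **conversely up to the local degree**: for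
  `E'/E` finite (`char E = 0`), a class dying over `E'` dies over `E` after multiplication by
  `[Γ_E : Γ_{Ẽ'}]`, in particular by `2` when `[E' : E] ≤ 2`.

References: [SerreGaloisCohomology1997] I.§2.4 (Cor. to Prop. 9), I.§5.8, II.§1.1;
[DokchitserDokchitserAnnals2010] Lemma 4.14 (proof); [MilneADT2006] I.§6.
-/

noncomputable section

open scoped Classical

open WeierstrassCurve
  Literature.NumberTheory.EllipticCurves
  Literature.NumberTheory.GaloisRepresentations

universe u

namespace Summit.BirchSwinnertonDyer.BirchSwinnertonDyer.Theorems.RamifiedSevenEllipticUnits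

section Tower

variable {K : Type u} [Field K] (W : WeierstrassCurve K) (p : ℕ)
variable {E : Type u} [Field E] [Algebra K E]
variable {E' : Type u} [Field E'] [Algebra K E'] [Algebra E E'] [IsScalarTower K E E']

/-! ## §1 The `p`-primary points map along an arbitrary embedding, and embedding independence -/

/-- The `p`-primary points map `E[p^∞](K̄) → E(K̄_E)[p^∞]` along a `K`-embedding `ι : K̄ → K̄_E`
maps `p`-primary points to `p`-primary points (so the codomain restriction below is legitimate).
[folklore] -/
theorem pointsMapOfEmb_mem_primaryComponent (ι : AlgebraicClosure K →ₐ[K] AlgebraicClosure E)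
    (P : W.geomPrimaryTorsion p) :
    pointsMapOfEmb W ι (P : geomPoints W) ∈ AddCommGroup.primaryComponent (localPoints W E) p :=
  map_mem_primaryComponent (pointsMapOfEmb W ι) P.2

/-- Equivariance of the `p`-primary points map along `ι` for `resGalOfEmb ι`. [folklore] -/
theorem primaryPointsMapOfEmb_smul (ι : AlgebraicClosure K →ₐ[K] AlgebraicClosure E)
    (σ : Field.absoluteGaloisGroup E) (P : W.geomPrimaryTorsion p) :
    (((pointsMapOfEmb W ι).comp (W.geomPrimaryTorsion p).subtype).codRestrict
        (AddCommGroup.primaryComponent (localPoints W E) p)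
        (pointsMapOfEmb_mem_primaryComponent W p ι)) (resGalOfEmb ι σ • P) =
      σ • (((pointsMapOfEmb W ι).comp (W.geomPrimaryTorsion p).subtype).codRestrict
        (AddCommGroup.primaryComponent (localPoints W E) p)
        (pointsMapOfEmb_mem_primaryComponent W p ι)) P :=
  Subtype.ext (pointsMapOfEmb_smul W ι σ (P : geomPoints W))

/-- **The strict local kernel does not depend on the embedding**: for every `K`-embedding
`ι : K̄ → K̄_E`, `selmerLocalKerPrimaryTorsion W E p` (defined with the chosen embedding) equals the
kernel of `H¹(K, E[p^∞]) → H¹(E, E(K̄_E)[p^∞])` along `(resGalOfEmb ι, ι_*)`. Two embeddings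
differ by `τ ∈ Γ_K` (`exists_algHom_eq_comp`), which conjugates the pair (`resGalOfEmb_comp`,
`pointsMapOfEmb_comp`), and inner automorphisms act trivially on `H¹` (`resKer_conj_comp`).
[cite: SerreGaloisCohomology1997, II.§1.1] -/
theorem selmerLocalKerPrimaryTorsion_eq_resKer_ofEmb
    (ι : AlgebraicClosure K →ₐ[K] AlgebraicClosure E) :
    selmerLocalKerPrimaryTorsion W E p =
      resKer (resGalOfEmb ι)
        (((pointsMapOfEmb W ι).comp (W.geomPrimaryTorsion p).subtype).codRestrict
          (AddCommGroup.primaryComponent (localPoints W E) p)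
          (pointsMapOfEmb_mem_primaryComponent W p ι))
        (primaryPointsMapOfEmb_smul W p ι) := by
  obtain ⟨τ, rfl⟩ := exists_algHom_eq_comp (closureEmb (K := K) E) ι
  have hψ : (((pointsMapOfEmb W ((closureEmb (K := K) E).comp
        (τ : AlgebraicClosure K →ₐ[K] AlgebraicClosure K))).comp
        (W.geomPrimaryTorsion p).subtype).codRestrict
          (AddCommGroup.primaryComponent (localPoints W E) p)
          (pointsMapOfEmb_mem_primaryComponent W p _)) =
      ((((pointsMapOfEmb W (closureEmb (K := K) E)).comp (W.geomPrimaryTorsion p).subtype).codRestrict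
          (AddCommGroup.primaryComponent (localPoints W E) p)
          (pointsMapOfEmb_mem_primaryComponent W p _)).comp
        (DistribSMul.toAddMonoidHom (W.geomPrimaryTorsion p)
          (show Field.absoluteGaloisGroup K from τ))) := by
    ext P
    change pointsMapOfEmb W ((closureEmb (K := K) E).comp
        (τ : AlgebraicClosure K →ₐ[K] AlgebraicClosure K)) (P : geomPoints W) =
      pointsMapOfEmb W (closureEmb (K := K) E) ((show Field.absoluteGaloisGroup K from τ) • (P : geomPoints W))
    rw [pointsMapOfEmb_comp]
    rfl
  rw [resKer_congr (resGalOfEmb_comp (closureEmb (K := K) E) τ) hψ, resKer_conj_comp]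
  rfl

/-! ## §2 Strict local kernels grow along a tower -/

omit [IsScalarTower K E E'] in
/-- The `p`-primary points map `E(K̄_E)[p^∞] → E(K̄_{E'})[p^∞]` along an `E`-embedding `ι₂` is
compatible with the maps from `E[p^∞](K̄)` along `ι₁` and `ι₂ ∘ ι₁` (`pointsMapOfEmb_comp_tower`).
[folklore] -/
theorem primaryPointsMapOfEmb_comp_tower [IsScalarTower K E E']
    (ι₁ : AlgebraicClosure K →ₐ[K] AlgebraicClosure E)
    (ι₂ : AlgebraicClosure E →ₐ[E] AlgebraicClosure E') :
    (((pointsMapOfEmb W ((ι₂.restrictScalars K).comp ι₁)).comp (W.geomPrimaryTorsion p).subtype).codRestrict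
        (AddCommGroup.primaryComponent (localPoints W E') p)
        (pointsMapOfEmb_mem_primaryComponent W p _)) =
      ((((pointsMapTower W ι₂).comp
          (AddCommGroup.primaryComponent (localPoints W E) p).subtype).codRestrict
          (AddCommGroup.primaryComponent (localPoints W E') p)
          (fun Q ↦ map_mem_primaryComponent (pointsMapTower W ι₂) Q.2)).comp
        (((pointsMapOfEmb W ι₁).comp (W.geomPrimaryTorsion p).subtype).codRestrict
          (AddCommGroup.primaryComponent (localPoints W E) p)
          (pointsMapOfEmb_mem_primaryComponent W p ι₁))) := by
  ext P
  change pointsMapOfEmb W ((ι₂.restrictScalars K).comp ι₁) (P : geomPoints W) =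
    pointsMapTower W ι₂ (pointsMapOfEmb W ι₁ (P : geomPoints W))
  rw [pointsMapOfEmb_comp_tower]
  rfl

omit [IsScalarTower K E E'] in
/-- Equivariance of the middle `p`-primary map along `resGalOfEmb ι₂`. [folklore] -/
theorem primaryPointsMapTower_smul [IsScalarTower K E E']
    (ι₂ : AlgebraicClosure E →ₐ[E] AlgebraicClosure E') (σ : Field.absoluteGaloisGroup E')
    (Q : AddCommGroup.primaryComponent (localPoints W E) p) :
    (((pointsMapTower W ι₂).comp
        (AddCommGroup.primaryComponent (localPoints W E) p).subtype).codRestrict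
        (AddCommGroup.primaryComponent (localPoints W E') p)
        (fun Q ↦ map_mem_primaryComponent (pointsMapTower W ι₂) Q.2)) (resGalOfEmb (K := E) ι₂ σ • Q) =
      σ • (((pointsMapTower W ι₂).comp
        (AddCommGroup.primaryComponent (localPoints W E) p).subtype).codRestrict
        (AddCommGroup.primaryComponent (localPoints W E') p)
        (fun Q ↦ map_mem_primaryComponent (pointsMapTower W ι₂) Q.2)) Q :=
  Subtype.ext (pointsMapTower_smul W ι₂ σ (Q : localPoints W E))

/-- **Strict local kernels grow along a tower `K → E → E'`.** A class of `H¹(K, E[p^∞])` dying in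
`H¹(E, E(K̄_E)[p^∞])` dies in `H¹(E', E(K̄_{E'})[p^∞])`: the restriction to `Γ_{E'}` along
`ι₂ ∘ ι₁` factors through the restriction to `Γ_E` (`resGalOfEmb_comp_tower`, `resH1Hom_comp`), and
the kernel at `E'` does not depend on the embedding (§1). Applied with `E = ℚ_p ⊂ E' = K_𝔮`.
[cite: SerreGaloisCohomology1997, I.§2.4 and II.§1.1] [cite: MilneADT2006, I.§6] -/
theorem selmerLocalKerPrimaryTorsion_le_of_tower :
    selmerLocalKerPrimaryTorsion W E p ≤ selmerLocalKerPrimaryTorsion W E' p := by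
  intro c hc
  let ι₁ : AlgebraicClosure K →ₐ[K] AlgebraicClosure E := closureEmb (K := K) E
  let ι₂ : AlgebraicClosure E →ₐ[E] AlgebraicClosure E' := closureEmb (K := E) E'
  rw [selmerLocalKerPrimaryTorsion_eq_resKer_ofEmb W p ((ι₂.restrictScalars K).comp ι₁),
    resKer_eq_ker, AddMonoidHom.mem_ker,
    resH1Hom_congr (resGalOfEmb_comp_tower ι₁ ι₂) (primaryPointsMapOfEmb_comp_tower W p ι₁ ι₂) _
      (fun x m ↦ by
        rw [ContinuousMonoidHom.comp_toFun, AddMonoidHom.comp_apply, primaryPointsMapOfEmb_smul,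
          primaryPointsMapTower_smul]
        rfl),
    ← resH1Hom_comp (resGalOfEmb ι₁) _ (primaryPointsMapOfEmb_smul W p ι₁)
      (resGalOfEmb (K := E) ι₂) _ (primaryPointsMapTower_smul W p ι₂), AddMonoidHom.comp_apply]
  have h0 : resH1Hom (resGalOfEmb ι₁) _ (primaryPointsMapOfEmb_smul W p ι₁) c = 0 := by
    rw [selmerLocalKerPrimaryTorsion_eq_resKer_ofEmb W p ι₁, resKer_eq_ker] at hc
    exact hc
  rw [h0, map_zero]

/-! ## §3 Conversely, up to the local degree -/

variable [FiniteDimensional E E'] [CharZero E]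

/-- For `E'/E` algebraic the middle `p`-primary points map along `ι₂` is bijective
(`pointsMapTower_bijective` restricted to `p`-primary parts; a preimage of a `p`-primary point is
`p`-primary by injectivity). [folklore] -/
theorem primaryPointsMapTower_bijective (ι₂ : AlgebraicClosure E →ₐ[E] AlgebraicClosure E') :
    Function.Bijective (((pointsMapTower W ι₂).comp
        (AddCommGroup.primaryComponent (localPoints W E) p).subtype).codRestrict
        (AddCommGroup.primaryComponent (localPoints W E') p)
        (fun Q ↦ map_mem_primaryComponent (pointsMapTower W ι₂) Q.2)) := by
  have hbij := pointsMapTower_bijective (K := K) W ι₂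
  refine ⟨fun Q R h ↦ Subtype.ext (hbij.1 (congrArg Subtype.val h)), fun Q' ↦ ?_⟩
  obtain ⟨Q, hQ⟩ := hbij.2 (Q' : localPoints W E')
  obtain ⟨k, hk⟩ := AddCommGroup.mem_primaryComponent.mp Q'.2
  have hQmem : Q ∈ AddCommGroup.primaryComponent (localPoints W E) p := by
    refine AddCommGroup.mem_primaryComponent.mpr ⟨k, hbij.1 ?_⟩
    rw [map_nsmul, hQ, map_zero]
    exact hk
  exact ⟨⟨Q, hQmem⟩, Subtype.ext hQ⟩

/-- **Up to `[Γ_E : Γ_{Ẽ'}]`, a class strict over `E'` is strict over `E`.** If `c ∈ H¹(K, E[p^∞])`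
dies in `H¹(E', E(K̄_{E'})[p^∞])` then `[Γ_E : Γ_{Ẽ'}] • c` dies in `H¹(E, E(K̄_E)[p^∞])`: the
restriction to `E'` factors through `E` (§2), the kernel of the middle map is inflated from `Γ_{Ẽ'}`
(`resKer_le_range_inflClass`, the coefficient map being bijective) and inflated classes are killed
by the index (`index_nsmul_inflClass`). The `p^∞`-torsion companion of
`index_nsmul_mem_localRestrictionKer_of_tower`. [cite: SerreGaloisCohomology1997, I.§2.4 Cor. to Prop. 9] -/
theorem index_nsmul_mem_selmerLocalKerPrimaryTorsion_of_tower {c : W.galH1Primary p}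
    (hc : c ∈ selmerLocalKerPrimaryTorsion W E' p) :
    (finGalSubgroup (E := E) E').index • c ∈ selmerLocalKerPrimaryTorsion W E p := by
  let ι₁ : AlgebraicClosure K →ₐ[K] AlgebraicClosure E := closureEmb (K := K) E
  let ι₂ : AlgebraicClosure E →ₐ[E] AlgebraicClosure E' := closureEmb (K := E) E'
  rw [selmerLocalKerPrimaryTorsion_eq_resKer_ofEmb W p ((ι₂.restrictScalars K).comp ι₁),
    resKer_eq_ker, AddMonoidHom.mem_ker,
    resH1Hom_congr (resGalOfEmb_comp_tower ι₁ ι₂) (primaryPointsMapOfEmb_comp_tower W p ι₁ ι₂) _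
      (fun x m ↦ by
        rw [ContinuousMonoidHom.comp_toFun, AddMonoidHom.comp_apply, primaryPointsMapOfEmb_smul,
          primaryPointsMapTower_smul]
        rfl),
    ← resH1Hom_comp (resGalOfEmb ι₁) _ (primaryPointsMapOfEmb_smul W p ι₁)
      (resGalOfEmb (K := E) ι₂) _ (primaryPointsMapTower_smul W p ι₂), AddMonoidHom.comp_apply,
    ← AddMonoidHom.mem_ker, ← resKer_eq_ker] at hc
  obtain ⟨f, hf⟩ := resKer_le_range_inflClass (resGalOfEmb (K := E) ι₂) _
    (primaryPointsMapTower_smul W p ι₂) (primaryPointsMapTower_bijective W p ι₂)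
    (finGalSubgroup (E := E) E') (isOpen_finGalSubgroup E') (finGalSubgroup_le_range_resGal E') hc
  have hkill := index_nsmul_inflClass (finGalSubgroup (E := E) E') (isOpen_finGalSubgroup E') f
  rw [hf, ← map_nsmul] at hkill
  rw [selmerLocalKerPrimaryTorsion_eq_resKer_ofEmb W p ι₁, resKer_eq_ker, AddMonoidHom.mem_ker]
  exact hkill

/-- **For `[E' : E] ≤ 2`, a class strict over `E'` becomes strict over `E` after multiplication by `2`.**
[cite: SerreGaloisCohomology1997, I.§2.4 Cor. to Prop. 9] -/
theorem two_nsmul_mem_selmerLocalKerPrimaryTorsion_of_tower (h : Module.finrank E E' ≤ 2)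
    {c : W.galH1Primary p} (hc : c ∈ selmerLocalKerPrimaryTorsion W E' p) :
    2 • c ∈ selmerLocalKerPrimaryTorsion W E p := by
  obtain ⟨k, hk⟩ := index_finGalSubgroup_dvd_two (E := E) E' h
  rw [hk, mul_nsmul]
  exact AddSubgroup.nsmul_mem _ (index_nsmul_mem_selmerLocalKerPrimaryTorsion_of_tower (E := E) W p hc) k

end Tower

/-! ## §4 The strict local condition under restriction to an intermediate field `L` -/

section BaseChange

variable {K : Type u} [Field K] (W : WeierstrassCurve K) (p : ℕ)
variable (L : Type u) [Field L] [Algebra K L]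
variable {E' : Type u} [Field E'] [Algebra K E'] [Algebra L E'] [IsScalarTower K L E']

/-- **Strict local conditions correspond under restriction to `L`.** For an `L`-field `E'` (a
completion `L_w`), a class `c ∈ H¹(K, E[p^∞])` dies in `H¹(E', E(K̄_{E'})[p^∞])` iff its restriction
`resPrimary W L p c ∈ H¹(L, E_L[p^∞])` dies in `H¹(E', E_L(L̄_{E'})[p^∞])`: both are the vanishing of
`c` under `Γ_{E'} → Γ_L → Γ_K`, up to the identification of coefficients — the `p^∞`-torsion
companion of `mem_localRestrictionKer_iff_resBaseChange_mem`. Applied with `K = ℚ`, `L` the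
quadratic field, `E' = L_𝔮` for `𝔮 ∣ p`. [cite: SerreGaloisCohomology1997, I.§2.4 and II.§1.1] [cite: DokchitserDokchitserAnnals2010, Lemma 4.14 (proof)] -/
theorem mem_selmerLocalKerPrimaryTorsion_iff_resPrimary_mem (c : W.galH1Primary p) :
    c ∈ selmerLocalKerPrimaryTorsion W E' p ↔
      resPrimary W L p c ∈ selmerLocalKerPrimaryTorsion (W.baseChange L) E' p := by
  let ιL : AlgebraicClosure K →ₐ[K] AlgebraicClosure L := closureEmb (K := K) L
  let ι₃ : AlgebraicClosure L →ₐ[L] AlgebraicClosure E' := closureEmb (K := L) E'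
  have hθ : ∀ (g : Field.absoluteGaloisGroup L)
      (m : AddCommGroup.primaryComponent (localPoints W L) p),
      primaryComponentCongr (localPointsEquivGeomPoints W L) p (g • m) =
        g • primaryComponentCongr (localPointsEquivGeomPoints W L) p m := fun g m ↦
    Subtype.ext (by
      rw [coe_primaryComponentCongr, primaryComponent.coe_smul, primaryComponent.coe_smul,
        coe_primaryComponentCongr, localPointsEquivGeomPoints_smul])
  let θN : AddCommGroup.primaryComponent (localPoints W E') p ≃+
      AddCommGroup.primaryComponent (localPoints (W.baseChange L) E') p :=
    primaryComponentCongr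
      (show localPoints W E' ≃+ localPoints (W.baseChange L) E' from
        pointsCongr W L (AlgebraicClosure E')) p
  have hθN : ∀ (σ : Field.absoluteGaloisGroup E')
      (n : AddCommGroup.primaryComponent (localPoints W E') p), θN (σ • n) = σ • θN n := fun σ n ↦
    Subtype.ext (by
      change (show localPoints W E' ≃+ localPoints (W.baseChange L) E' from
          pointsCongr W L (AlgebraicClosure E')) (σ • (n : localPoints W E')) =
        σ • (show localPoints W E' ≃+ localPoints (W.baseChange L) E' from
          pointsCongr W L (AlgebraicClosure E')) (n : localPoints W E')
      rw [localPoints.smul_def, localPoints.smul_def]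
      exact pointsCongr_map W L
        ((AlgEquiv.restrictScalars L
          (show AlgebraicClosure E' ≃ₐ[E'] AlgebraicClosure E' from σ)) :
            AlgebraicClosure E' →ₐ[L] AlgebraicClosure E') (n : localPoints W E'))
  have key : h1Equiv (primaryComponentCongr (localPointsEquivGeomPoints W L) p) hθ
      (resH1Hom (resGalOfEmb ιL) _ (primaryPointsMapOfEmb_smul W p ιL) c) = resPrimary W L p c := by
    rw [h1Equiv_apply, resH1Hom_resH1Hom, resPrimary]
    refine congrFun (congrArg DFunLike.coe (resH1Hom_congr (by ext; rfl) ?_ _ _)) c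
    exact AddMonoidHom.ext fun m ↦ Subtype.ext rfl
  rw [selmerLocalKerPrimaryTorsion_eq_resKer_ofEmb W p ((ι₃.restrictScalars K).comp ιL),
    resKer_eq_ker, AddMonoidHom.mem_ker,
    resH1Hom_congr (resGalOfEmb_comp_tower ιL ι₃) (primaryPointsMapOfEmb_comp_tower W p ιL ι₃) _
      (fun x m ↦ by
        rw [ContinuousMonoidHom.comp_toFun, AddMonoidHom.comp_apply, primaryPointsMapOfEmb_smul,
          primaryPointsMapTower_smul]
        rfl),
    ← resH1Hom_comp (resGalOfEmb ιL) _ (primaryPointsMapOfEmb_smul W p ιL)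
      (resGalOfEmb (K := L) ι₃) _ (primaryPointsMapTower_smul W p ι₃), AddMonoidHom.comp_apply,
    ← AddMonoidHom.mem_ker, ← resKer_eq_ker,
    mem_resKer_iff_h1Equiv_mem (resGalOfEmb (K := L) ι₃) _ (primaryPointsMapTower_smul W p ι₃)
      _ (primaryPointsMapOfEmb_smul (W.baseChange L) p ι₃)
      (primaryComponentCongr (localPointsEquivGeomPoints W L) p) hθ θN hθN
      (fun m ↦ Subtype.ext (by
        change pointsMapOfEmb (W.baseChange L) ι₃ (localPointsEquivGeomPoints W L (m : localPoints W L)) =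
          pointsCongr W L (AlgebraicClosure E') (pointsMapTower W ι₃ (m : localPoints W L))
        exact (pointsCongr_map W L ι₃ (m : localPoints W L)).symm)),
    key]
  rfl

end BaseChange

end Summit.BirchSwinnertonDyer.BirchSwinnertonDyer.Theorems.RamifiedSevenEllipticUnits

end
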